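import Summits.Ventures.GridStability.Models.NE39SP
import Summits.Ventures.GridStability.Lyapunov.StructurePreservingSwitchRoa
import HarnessLib

/-!
# GridStability/Bench/NE39SPSwitch2Defs — N−2 (double) switching on the 49-node STRUCTURE-PRESERVING New England
# instance: the post-switch model «branches `k` and `l` opened together, injections kept» and the switching
# theorem specialised to it (line «G2.b-NE39SP-N1-SWITCH», N−2 extension, file 0 of that series)

Cell `gridfusion` (LADDER-GRIDFUSION), seat gridfusion-lyap-1 (g9). INSTANCE OF RECORD BY NAME: model-2's
`Models/NE39SP.lean` (`NE39SP.params D`; data model-4 `bench/data/NE39/sp49/sp49.json` fddec35dcf838149 =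
[cite: Padiyar2013, App. D Tables D.1–D.4]: edge list `srcV`/`tgtV` (56 coupled pairs = 34 lines + 12
transformers + 10 machine reactances), column-LF couplings `wtLFQ`, half-angle tangents `tLFQ` of the
synchronous state `δ₀`, injections `P⁰ := f(δ₀)`, inertias `MQ`, generator set `genS`; the damping /
load-frequency vector `D > 0` is a PARAMETER). GENERIC THEOREM OF RECORD: this seat's
`Switch.switch_resync_of_check` (`Lyapunov/StructurePreservingSwitchRoa.lean`); the N−1 sibling is
`Bench/NE39SPSwitchDefs.lean` (`wOpen`, `paramsOpen`, `switch_resync_open`). NO NEW DATA LITERAL.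

WHAT IS HERE: `wOpen2 k l` (the post-switch weights: listed branches `k` AND `l` opened at the same instant,
every other coupling of record kept), `paramsOpen2 k l D` (SAME `M`, `D`, `P⁰`, `gen` as `NE39SP.params D`,
couplings from `wOpen2 k l`), its bookkeeping lemmas, and **`switch2_resync_open`** — the switching theorem for
this instance modulo ONE hypothesis `C.check srcV tgtV wtLFQ (wOpen2 k l) tLFQ 39`, discharged pair by pair in
`Bench/NE39SPLineSwitch2*.lean` with `decide`. THREE COLUMNS: CERTIFIED (there) = for MODEL M′ₖₗ = MV-3 New England SP with branches `k`, `l`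
open and the injections of record: existence of the post-switch synchronous state (enclosed) and
re-synchronisation of EVERY solution from the pre-switch synchronous state, for every `D > 0`; MODELLED =
model-2's tokens «MV-3 + lossless + MV-P + D(∀) + ω_s declared + V-frozen(LF) + |E|′(h12)» PLUS «both
branches opened at t = 0 WITHOUT a fault, no reclosure, no protection action, tap ratios as in column LF;
branches whose opening islands a bus or machine are out of scope»; VALIDATED = nothing (no printed
time-domain comparison exists for this model). No sentence here says the New England system is stable
or N−2 secure. Two definitions (`wOpen2`, `paramsOpen2`); no named fact; standard axioms.
-/

noncomputable section

open Set Filter Topology Real Finset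
open Summit.Ventures.GridStability.Models
open Summit.Ventures.GridStability.Models.StructurePreserving
open Summit.Ventures.GridStability.Models.NE39SP
open Summit.Ventures.GridStability.Lyapunov.StructurePreserving
open Summit.Ventures.GridStability.Lyapunov.StructurePreserving.Switch

namespace Summit.Ventures.GridStability.Bench.NE39SP

/-- **Post-switch couplings: listed branches `k` and `l` OPENED together** (their couplings set to `0`), every
other column-LF coupling of record kept (`NE39SP.wtLFQ`). MODELLED: double switching without fault. [folklore] -/
def wOpen2 (k l : Fin 56) (e : Fin 56) : ℚ := if e = k then 0 else if e = l then 0 else NE39SP.wtLFQ e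

/-- **The post-switch structure-preserving data** `M′ₖₗ`: model-2's `NE39SP.params D` with the couplings
replaced by those of `wOpen2 k l` — SAME inertias, damping / load-frequency vector `D`, injections
`P⁰ := f(δ₀)` of record and generator set. MODEL MV-3. [folklore] -/
def paramsOpen2 (k l : Fin 56) (D : Fin 49 → ℝ) : Params 49 :=
  { NE39SP.params D with b := symmetrize (edgeWeight NE39SP.srcV NE39SP.tgtV fun e => (wOpen2 k l e : ℝ)) }

/-- Unfolding: the post-switch couplings. [folklore] -/
theorem paramsOpen2_b (k l : Fin 56) (D : Fin 49 → ℝ) :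
    (paramsOpen2 k l D).b = symmetrize (edgeWeight NE39SP.srcV NE39SP.tgtV fun e => (wOpen2 k l e : ℝ)) :=
  rfl

/-- Unfolding: the damping / load-frequency vector is the parameter `D`. [folklore] -/
theorem paramsOpen2_D (k l : Fin 56) (D : Fin 49 → ℝ) : (paramsOpen2 k l D).D = D := rfl

/-- Unfolding: the generator set is model-2's `genS`. [folklore] -/
theorem paramsOpen2_gen (k l : Fin 56) (D : Fin 49 → ℝ) : (paramsOpen2 k l D).gen = NE39SP.genS := rfl

/-- **The injections are KEPT**: `(paramsOpen2 k l D).P0ᵢ = fᵢ(δ₀)` = the rational mirror `flowQ` of the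
PRE-switch couplings at the pre-switch half-angle point (kit lemma `pe_halfAngle_eq_flowQ`). [folklore] -/
theorem paramsOpen2_P0 (k l : Fin 56) (D : Fin 49 → ℝ) (i : Fin 49) :
    (paramsOpen2 k l D).P0 i
      = flowQ NE39SP.srcV NE39SP.tgtV (fun e => (NE39SP.wtLFQ e : ℝ)) (fun j => (NE39SP.tLFQ j : ℝ)) i := by
  show (NE39SP.params D).pe NE39SP.δ₀ i = _
  rw [Params.pe, params_b]
  exact pe_halfAngle_eq_flowQ NE39SP.srcV NE39SP.tgtV NE39SP.wt NE39SP.t i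

/-- **Well-formedness of the post-switch data** (printed sign pattern of `M` from model-2's
`NE39SP.wellFormed`, `D > 0` the hypothesis, symmetric couplings). [folklore] -/
theorem paramsOpen2_wellFormed (k l : Fin 56) {D : Fin 49 → ℝ} (hD : ∀ i, 0 < D i) :
    (paramsOpen2 k l D).WellFormed where
  M_pos := (NE39SP.wellFormed hD).M_pos
  M_eq_zero := (NE39SP.wellFormed hD).M_eq_zero
  D_pos := hD
  b_symm := fun i j => symmetrize_symm _ i j

/-- **THE DOUBLE-SWITCHING THEOREM FOR THE NEW ENGLAND SP INSTANCE, modulo one rational check.** For listed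
branches `k`, `l` and a certificate `C` with `C.check srcV tgtV wtLFQ (wOpen2 k l) tLFQ 39`: for EVERY damping /
load-frequency vector `D > 0`, the post-switch model `M′ₖₗ = paramsOpen2 k l D` (both branches opened at
`t = 0` without fault, injections of record kept) HAS a synchronous angle vector `θ` — all 49 lossless
power-flow equations `fᵢ(θ) = P⁰ᵢ` exactly, pinned at G1's internal node to the certificate's half-angle
point and within `R` of it at every node, every coupled branch inside `2·arctan τγ < π/2` — and EVERY
solution `δ` of `M′ₖ` AS PRINTED starting at the PRE-switch synchronous state (`δ(0) = δ₀`, zero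
generator frequency deviations) keeps Vu–Turitsyn's polytope `|(δᵢ − δⱼ) + (θᵢ − θⱼ)| < π` on coupled
pairs and `V(θ; δ(t), δ̇(t)) ≤ c` for all `t ≥ 0`, and re-synchronises: `δ(t) → θ + κ·1`,
`κ = Σ Dᵢ(δ₀ᵢ − θᵢ)/Σ Dᵢ`, `δ̇ᵢ(t) → 0` at every machine. MODEL MV-3; no sentence here says the New
England system is stable or N−2 secure. [cite: VuTuritsyn2016, §IV, §VI; Padiyar2013, App. D] -/
theorem switch2_resync_open {k l : Fin 56} {C : Cert 49 56}
    (hchk : C.check NE39SP.srcV NE39SP.tgtV NE39SP.wtLFQ (wOpen2 k l) NE39SP.tLFQ 39)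
    (D : Fin 49 → ℝ) (hD : ∀ i, 0 < D i) :
    ∃ θ : Fin 49 → ℝ,
      θ 39 = halfAngle (fun i => (C.t1 i : ℝ)) 39 ∧
      (∀ i, |θ i - halfAngle (fun i => (C.t1 i : ℝ)) i| < (C.R : ℝ)) ∧
      (∀ i, (paramsOpen2 k l D).pe θ i = (paramsOpen2 k l D).P0 i) ∧
      (∀ i j, i ≠ j → (paramsOpen2 k l D).b i j ≠ 0 → |θ i - θ j| < 2 * Real.arctan (C.τγ : ℝ)) ∧
      ∀ δ : ℝ → Fin 49 → ℝ, (paramsOpen2 k l D).IsSolution δ → δ 0 = NE39SP.δ₀ →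
        (∀ i ∈ NE39SP.genS, deriv (fun u => δ u i) 0 = 0) →
        (∀ t, 0 ≤ t →
            (∀ i j, (paramsOpen2 k l D).b i j ≠ 0 → |(δ t i - δ t j) + (θ i - θ j)| < π) ∧
              (paramsOpen2 k l D).energy θ (δ t) (fun i => deriv (fun u => δ u i) t) ≤ (C.c : ℝ)) ∧
          Tendsto δ atTop (𝓝 fun i => θ i + (∑ j, D j * (NE39SP.δ₀ j - θ j)) / ∑ j, D j) ∧
          ∀ i ∈ NE39SP.genS, Tendsto (fun t => deriv (fun u => δ u i) t) atTop (𝓝 0) :=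
  switch_resync_of_check hchk (by decide) (paramsOpen2_wellFormed k l hD) (paramsOpen2_b k l D)
    (paramsOpen2_P0 k l D)

end Summit.Ventures.GridStability.Bench.NE39SP

end
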